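import Summits.HubbardSuperconductivity.HubbardSuperconductivity.Theorems.WeakCouplingBCSKlLindhardEnclosureHyperbolaBA
import Summits.HubbardSuperconductivity.HubbardSuperconductivity.Theorems.WeakCouplingBCSKlLindhardEnclosureHyperbolaAB
import Summits.HubbardSuperconductivity.HubbardSuperconductivity.Theorems.WeakCouplingBCSKlLindhardEnclosureChord

/-!
# KL-MARGIN-SCAN reader (22) «kernel-lindhard-enclosure» — the MAJORISED-HYPERBOLA ceiling rule DISCHARGED

`ceilBdrySoundOrd : ∀ P, CeilBdrySoundOrd P` — the single-straddle ceiling of the instrument is sound for EVERY parameter record, with no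
side condition.  The kernel's `ceilBdry` returns the minimum of the available variants `vAB` (2-D substitution, 8 abscissa pieces), `vB`
(ordinate substitution), `vA` (abscissa substitution) and the default `2^200`; each available variant is a certified ceiling by
`…HyperbolaBA` / `…HyperbolaAB`, the default by the crude bound (`…Crude.ceilCrudeSoundOrd` + a size estimate), and a minimum of certified
ceilings is certified (`ceilValid_min`).  With `…SameSide`, `…Crude`, `…Chord`, the CEILING debt of `CeilSoundAt P t` (all trees) is now
the TIP RULE alone (`ceilSoundAt_of_tip`).  Honest framing: nothing in this file asserts a KL margin at any `t′ ≠ 0`, `K₃`, `U₀`, the window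
or B1g dominance; a Kohn–Luttinger instability statement is not ODLRO and nothing here proves superconductivity in the Hubbard model.
(p1 g26, 2026-08-29.)
-/

noncomputable section

set_option linter.dupNamespace false

namespace Summit.HubbardSuperconductivity.HubbardSuperconductivity.Theorems.KlLindhardEnclosure

open Real Set MeasureTheory Literature.MathematicalPhysics.QuantumLattice
open Summit.HubbardSuperconductivity.HubbardSuperconductivity.Theorems

/-! ## §1 The `2^200` default is a certified ceiling (via the crude bound) -/

/-- A certified ceiling stays certified when enlarged. -/
theorem Params.ceilValid_mono (P : Params) {a b c d u w : ℤ} (hu : P.CeilValid a b c d u) (huw : u ≤ w) : P.CeilValid a b c d w :=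
  ⟨hu.1, hu.2.trans (by exact_mod_cast huw)⟩

/-- The certified distance floor is non-negative. -/
theorem Params.distLoZ_nonneg (P : Params) (eLo eHi : ℤ) : 0 ≤ P.distLoZ eLo eHi := by
  unfold Params.distLoZ
  rcases P.status eLo eHi with _ | ⟨_ | _⟩ <;> simp

/-- What `piecesOK` certifies. -/
theorem Params.piecesOK_facts (P : Params) {lo hi : ℤ} (h : P.piecesOK lo hi = true) :
    0 < P.sDnZ lo ∧ 0 < P.sDnZ hi ∧ lo ≤ hi := by
  simp only [Params.piecesOK, Bool.and_eq_true, decide_eq_true_eq] at h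
  exact ⟨h.1.1.1.1, h.1.1.1.2, h.1.1.2⟩

/-- **THE DEFAULT `2^200` IS A CERTIFIED CEILING** of any guarded, oriented cell inside the root square with a positive distance floor at one
of its two points (crude bound `2^30·2^40·area/L`, area `≤ (2Xz/U)² ≤ 13²`). -/
theorem Params.ceilValid_big (P : Params) (hP : P.admissible = true) {a b c d : ℤ} (hin : P.InRoot a b c d) (hab : a ≤ b) (hcd : c ≤ d)
    (hg : (P.cell (P.mkX a) (P.mkX b) (P.mkY c) (P.mkY d)).guards = true)
    (hL : 0 < P.distLoZ (P.cell (P.mkX a) (P.mkX b) (P.mkY c) (P.mkY d)).e1Lo (P.cell (P.mkX a) (P.mkX b) (P.mkY c) (P.mkY d)).e1Hi +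
      P.distLoZ (P.cell (P.mkX a) (P.mkX b) (P.mkY c) (P.mkY d)).e2Lo (P.cell (P.mkX a) (P.mkX b) (P.mkY c) (P.mkY d)).e2Hi) :
    P.CeilValid a b c d (2 ^ 200) := by
  obtain ⟨-, -, hU, hq1, -⟩ := P.admissible_facts hP
  have hpi : P.piLoZ * 1000000 ≤ 3141592 * P.U := by
    simp only [Params.admissible, Bool.and_eq_true, decide_eq_true_eq] at hP; exact hP.1.1.1.1.1.2
  set L := P.distLoZ (P.cell (P.mkX a) (P.mkX b) (P.mkY c) (P.mkY d)).e1Lo (P.cell (P.mkX a) (P.mkX b) (P.mkY c) (P.mkY d)).e1Hi +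
      P.distLoZ (P.cell (P.mkX a) (P.mkX b) (P.mkY c) (P.mkY d)).e2Lo (P.cell (P.mkX a) (P.mkX b) (P.mkY c) (P.mkY d)).e2Hi with hLdef
  have hcr : P.ceilCrude (P.cell (P.mkX a) (P.mkX b) (P.mkY c) (P.mkY d)) (P.mkX a) (P.mkX b) (P.mkY c) (P.mkY d) =
      some (cdivZ (2 ^ 30 * (b - a) * (d - c) * D) (P.U ^ 2 * L)) := by
    simp only [Params.ceilCrude, Params.mkX_z, Params.mkY_z, ← hLdef, if_pos hL]
  have hv := ceilCrudeSoundOrd P a b c d _ hP hin hab hcd hg hcr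
  apply P.ceilValid_mono hv
  -- size: cdivZ x y ≤ x/y + 1 ≤ 2^70·(b−a)(d−c)/U² + 1 ≤ 2^70·(2Xz)²/U² + 1 ≤ 2^70·13² + 1 ≤ 2^200
  obtain ⟨ha, -, -, hb, hc, -, -, hd⟩ := hin
  have hq := abs_nonneg P.q1z
  have hba : b - a ≤ 13 * P.U := by omega
  have hdc : d - c ≤ 13 * P.U := by omega
  have hden : 0 < P.U ^ 2 * L := by positivity
  have h1 := cdivZ_sub_one_lt_div (2 ^ 30 * (b - a) * (d - c) * D) (P.U ^ 2 * L) hden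
  have h2 : ((2 ^ 30 * (b - a) * (d - c) * D : ℤ) : ℚ) / ((P.U ^ 2 * L : ℤ) : ℚ) ≤ 2 ^ 30 * 13 * 13 * 2 ^ 40 := by
    rw [div_le_iff₀ (by exact_mod_cast hden)]
    have hL1 : (1 : ℚ) ≤ (L : ℚ) := by exact_mod_cast hL
    have hba' : ((b - a : ℤ) : ℚ) ≤ 13 * (P.U : ℚ) := by exact_mod_cast hba
    have hdc' : ((d - c : ℤ) : ℚ) ≤ 13 * (P.U : ℚ) := by exact_mod_cast hdc
    have hba0 : (0 : ℚ) ≤ ((b - a : ℤ) : ℚ) := by exact_mod_cast (sub_nonneg.mpr hab)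
    have hdc0 : (0 : ℚ) ≤ ((d - c : ℤ) : ℚ) := by exact_mod_cast (sub_nonneg.mpr hcd)
    have hU' : (0 : ℚ) < (P.U : ℚ) := by exact_mod_cast hU
    push_cast [D] at hba' hdc' hba0 hdc0 ⊢
    have e1 : ((b : ℚ) - a) * ((d : ℚ) - c) ≤ (13 * (P.U : ℚ)) * (13 * (P.U : ℚ)) := mul_le_mul hba' hdc' hdc0 (by positivity)
    nlinarith [e1, hL1, mul_nonneg (mul_nonneg hba0 hdc0) (sub_nonneg.mpr hL1), sq_nonneg (P.U : ℚ)]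
  generalize hX : ((2 ^ 30 * (b - a) * (d - c) * D : ℤ) : ℚ) / ((P.U ^ 2 * L : ℤ) : ℚ) = X at h1 h2
  have h3 : ((cdivZ (2 ^ 30 * (b - a) * (d - c) * D) (P.U ^ 2 * L) : ℤ) : ℚ) < 2 ^ 30 * 13 * 13 * 2 ^ 40 + 1 := by linarith
  have h4 : (2 : ℚ) ^ 30 * 13 * 13 * 2 ^ 40 + 1 ≤ 2 ^ 200 := by norm_num
  exact_mod_cast (h3.trans_le h4).le

/-! ## §2 The rule -/

/-- **THE MAJORISED-HYPERBOLA RULE HOLDS for every `P`.** -/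
theorem ceilBdrySoundOrd (P : Params) : CeilBdrySoundOrd P := by
  intro a b c d sh far τx τy u hP hin hab hcd hg hs1 hs2 hu
  cases sh
  · -- straddler `p`, far point `p + q`
    simp only [Bool.false_eq_true, ↓reduceIte] at hs1 hs2
    simp only [Params.ceilBdry, Params.mkX_z, Params.mkY_z, Bool.false_eq_true, ↓reduceIte] at hu
    revert hu
    cases hx : (sinLoOK (P.cell (P.mkX a) (P.mkX b) (P.mkY c) (P.mkY d)).aLo (P.cell (P.mkX a) (P.mkX b) (P.mkY c) (P.mkY d)).aUp τx && decide (0 < τx)) <;>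
    cases hy : (sinLoOK (P.cell (P.mkX a) (P.mkX b) (P.mkY c) (P.mkY d)).bLo (P.cell (P.mkX a) (P.mkX b) (P.mkY c) (P.mkY d)).bUp τy && decide (0 < τy)) <;> intro hu <;>
    split at hu <;> rename_i hmain <;>
    simp only [Bool.false_eq_true, ↓reduceIte, Bool.and_self, Bool.and_true, Bool.and_false, Option.some.injEq, reduceCtorEq] at hu
    all_goals
      simp only [Bool.and_eq_true, decide_eq_true_eq] at hmain
      obtain ⟨⟨⟨⟨hV, hpa⟩, hpb⟩, hdzx⟩, hdzy⟩ := hmain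
      obtain ⟨haLo, haUp, haa⟩ := P.piecesOK_facts hpa
      obtain ⟨hbLo, hbUp, hbb⟩ := P.piecesOK_facts hpb
      have hab' : a < b := by omega
      have hcd' : c < d := by omega
      have hbig := P.ceilValid_big hP hin hab hcd hg (by
        have := P.distLoZ_nonneg (P.cell (P.mkX a) (P.mkX b) (P.mkY c) (P.mkY d)).e1Lo (P.cell (P.mkX a) (P.mkX b) (P.mkY c) (P.mkY d)).e1Hi
        omega)
      subst hu
    -- (hx, hy) = (false, true): vB only
    · simp only [Bool.and_eq_true, decide_eq_true_eq] at hy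
      exact P.ceilValid_min (P.vB_nsh_valid hP hin hab' hcd' far hg hs2 haLo haUp hV hy.2 hy.1) hbig
    -- (true, false): vA only
    · simp only [Bool.and_eq_true, decide_eq_true_eq] at hx
      exact P.ceilValid_min (P.vA_nsh_valid hP hin hab' hcd' far hg hs2 hbLo hbUp hV hx.2 hx.1) hbig
    -- (true, true): all three
    · simp only [Bool.and_eq_true, decide_eq_true_eq] at hx hy
      exact P.ceilValid_min (P.vAB_nsh_valid hP hin hab' hcd' far hg hs2 haLo haUp haa hV hx.2 hy.2 hx.1 hy.1)
        (P.ceilValid_min (P.vB_nsh_valid hP hin hab' hcd' far hg hs2 haLo haUp hV hy.2 hy.1)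
          (P.ceilValid_min (P.vA_nsh_valid hP hin hab' hcd' far hg hs2 hbLo hbUp hV hx.2 hx.1) hbig))
  · -- straddler `p + q`, far point `p`
    simp only [↓reduceIte] at hs1 hs2
    simp only [Params.ceilBdry, Params.mkX_z, Params.mkY_z, ↓reduceIte] at hu
    revert hu
    cases hx : (sinLoOK (P.cell (P.mkX a) (P.mkX b) (P.mkY c) (P.mkY d)).aLo' (P.cell (P.mkX a) (P.mkX b) (P.mkY c) (P.mkY d)).aUp' τx && decide (0 < τx)) <;>
    cases hy : (sinLoOK (P.cell (P.mkX a) (P.mkX b) (P.mkY c) (P.mkY d)).bLo' (P.cell (P.mkX a) (P.mkX b) (P.mkY c) (P.mkY d)).bUp' τy && decide (0 < τy)) <;> intro hu <;>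
    split at hu <;> rename_i hmain <;>
    simp only [Bool.false_eq_true, ↓reduceIte, Bool.and_self, Bool.and_true, Bool.and_false, Option.some.injEq, reduceCtorEq] at hu
    all_goals
      simp only [Bool.and_eq_true, decide_eq_true_eq] at hmain
      obtain ⟨⟨⟨⟨hV, hpa⟩, hpb⟩, hdzx⟩, hdzy⟩ := hmain
      obtain ⟨haLo, haUp, haa⟩ := P.piecesOK_facts hpa
      obtain ⟨hbLo, hbUp, hbb⟩ := P.piecesOK_facts hpb
      have hab' : a < b := by omega
      have hcd' : c < d := by omega
      have hbig := P.ceilValid_big hP hin hab hcd hg (by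
        have := P.distLoZ_nonneg (P.cell (P.mkX a) (P.mkX b) (P.mkY c) (P.mkY d)).e2Lo (P.cell (P.mkX a) (P.mkX b) (P.mkY c) (P.mkY d)).e2Hi
        omega)
      subst hu
    -- (hx, hy) = (false, true): vB only
    · simp only [Bool.and_eq_true, decide_eq_true_eq] at hy
      exact P.ceilValid_min (P.vB_sh_valid hP hin hab' hcd' far hg hs1 haLo haUp hV hy.2 hy.1) hbig
    -- (true, false): vA only
    · simp only [Bool.and_eq_true, decide_eq_true_eq] at hx
      exact P.ceilValid_min (P.vA_sh_valid hP hin hab' hcd' far hg hs1 hbLo hbUp hV hx.2 hx.1) hbig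
    -- (true, true): all three
    · simp only [Bool.and_eq_true, decide_eq_true_eq] at hx hy
      exact P.ceilValid_min (P.vAB_sh_valid hP hin hab' hcd' far hg hs1 haLo haUp haa hV hx.2 hy.2 hx.1 hy.1)
        (P.ceilValid_min (P.vB_sh_valid hP hin hab' hcd' far hg hs1 haLo haUp hV hy.2 hy.1)
          (P.ceilValid_min (P.vA_sh_valid hP hin hab' hcd' far hg hs1 hbLo hbUp hV hx.2 hx.1) hbig))

/-- **CEILING SOUNDNESS FROM THE TIP RULE ALONE**, for every certificate tree. -/
theorem ceilSoundAt_of_tip (P : Params) (hT : CeilTipSoundOrd P) (t : QB) : CeilSoundAt P t :=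
  ceilSoundAt_of_two_rules P (ceilBdrySoundOrd P) hT t

end Summit.HubbardSuperconductivity.HubbardSuperconductivity.Theorems.KlLindhardEnclosure

end
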